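import Summits.QuantumAdvantage.QuantumAdvantage.Theorems.SosSandwichTransferPBKeyedLanguage
import Literature.Computability.QuantumComplexity.KeyedTruncBlocks
import HarnessLib

/-!
# Crux `TransferPB` (stmt-QuantumAdvantage-15238, route SosSandwich), line `birth` — the truncated-runs estimator: MEAN and SINGLE semantics

Obligation (Q) of the last stub `stub_pbOracleSimulation` (`nodeProblem F r c k ∈ PromiseBQP`). The joint quantum estimator of
the three node tests is ONE keyed BLOCKS run (`Literature/…/KeyedTruncBlocks.lean`, `KeyedBlocks.trunc`: on an instance of
length `L` with `n = nOf L`, `T(n) + 1` blocks — block `b < T` the truncation of `F.circ n` before its `b`-th oracle gate,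
block `T` the full run — on disjoint wires behind shared Hadamard keys, block `b` reading the `b`-th input segment of the
instance, every query re-targeted to (parameter part ++ key)). This file fixes the run `truncRun F nOf` (key width
`keyPoly (2T(n) + n + anc(n))`, the hash parameters of `Theorems/…KeyedLanguage.lean`) and proves its semantics relative to
the ONE oracle language `keyedLang F`, on every instance `z` that is WELL LAID OUT for `(x, ρ, t, pad)` — `nOf |z| = |x|`,
every input segment is a copy of `x`, and the parameter part is `paramStr ⟨x, ⟨encPath ρ, t⟩⟩ pad`:

* **`kernelProb_truncRun_full_eq_nodeMean`** — the answer wire of the FULL block reads `1` with probability EXACTLY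
  `nodeMean F x ρ = E_y[p_x|_ρ(y)]` (the MEAN node quantity);
* **`sum_kernelProb_truncRun_query_eq_bbbvMag`** — `4T · Σ_{b<T} Pr[the query register of block b spells σ(s)]` is EXACTLY
  `bbbvMag F x ρ s` (the SINGLE node quantity; `trunc_kernelProb_query`, `prefixSlice_keyedLang`, `bbbvMag_eq_hashedAvg`).

What remains for (Q): the BLOCK identity (the same sum for the event "`u ⊑` query register", via
`QueryWeightsAdditive.lean` + `blockMag_eq_hashedAvg`), the classical layout with `T+1` copies of `x` in `FP`, uniformity of
`(truncRun F nOf).family`, oracle removal (as in `Theorems/…MeanPromiseBQP.lean`) and the block-statistic read-out.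
All proved; no named fact. Sources: C. H. Bennett, E. Bernstein, G. Brassard, U. Vazirani, SIAM J. Comput. 26 (1997),
Def. 3.2 / Cor. 3.4; M. Zhandry, CRYPTO 2012, Thm. 3.1; S. Aaronson, A. Ambainis, Theory Comput. 10 (2014), proof of Thm. 23.
-/

-- D-0017: single-conjunct summit ⇒ the duplicate `QuantumAdvantage.QuantumAdvantage` is mandated.
set_option linter.dupNamespace false

noncomputable section

namespace Summit.QuantumAdvantage.QuantumAdvantage.Cruxes.TransferPB.Birth

open Finset Literature.Computability.Cryptography Literature.Computability.Complexity
  Literature.Computability.QuantumComplexity Literature.Computability.QuantumComplexity.ClassicalSimulation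
  Literature.Computability.Cryptography.ExplicitKWiseHash

namespace SimTreePB

variable (F : QCircuitFamily cliffordT)

/-- **The truncated-runs estimator of the node tests**: the keyed blocks run of `F` with input-length function `nOf`
and key width `keyPoly (2T(n) + n + anc(n))`, `n` the (clipped) block input length.
[cite: BennettBernsteinBrassardVazirani1997, Cor. 3.4 (proof)] [cite: Zhandry2012IBE, Thm. 3.1] -/
abbrev truncRun (nOf : ℕ → ℕ) : KeyedBlocks :=
  KeyedBlocks.trunc F nOf fun L =>
    keyPoly.eval (kOf F (KeyedBlocks.truncNOf F nOf L) + mOf F (KeyedBlocks.truncNOf F nOf L))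

variable {F}

/-- A padded input read through `getD` is the padded input. [folklore] -/
theorem padInput_getD_eq (x : List Bool) (m : ℕ) :
    padInput (fun i : Fin x.length => x.getD (i : ℕ) false) m = padInput x.get m := by
  congr 1
  funext i
  rw [List.getD_eq_getElem _ _ i.2]
  rfl

/-- Summing the entries of a list over `Fin N`, `N` its length. [folklore] -/
theorem sum_getElem_eq_sum (l : List ℝ) : ∀ (N : ℕ) (h : N = l.length),
    (∑ b : Fin N, l[(b : ℕ)]'(by rw [← h]; exact b.2)) = l.sum
  | _, rfl => by
    conv_rhs => rw [← List.ofFn_getElem (xs := l)]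
    rw [List.sum_ofFn]

/-- **The MEAN semantics of the truncated-runs estimator.** On an instance `z` well laid out for `(x, ρ, t, pad)`, the
transported answer wire of the full block `b` (`b ≥ T`) reads `1` with probability `nodeMean F x ρ`.
[cite: Zhandry2012IBE, Thm. 3.1] [cite: AaronsonAmbainis2014, Thm. 23 (proof, p. 14)] -/
theorem kernelProb_truncRun_full_eq_nodeMean (nOf : ℕ → ℕ) (z x : List Bool)
    (ρ : List (Fin (numOracleBits F x) × Bool)) (t pad : List Bool)
    (hn : (truncRun F nOf).nOf z.length = x.length)
    (b : Fin ((truncRun F nOf).MOf z.length))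
    (hb : (oraclePositions (F.circ ((truncRun F nOf).nOf z.length)).gates).length ≤ (b : ℕ))
    (hseg : (truncRun F nOf).inpB z b = fun i : Fin ((truncRun F nOf).nOf z.length) => x.getD (i : ℕ) false)
    (hdrop : z.drop ((truncRun F nOf).MOf z.length * (truncRun F nOf).nOf z.length) =
      paramStr (boolPair x (boolPair (encPath F x ρ) t)) pad) :
    (truncRun F nOf).family.kernelProb (keyedLang F) z
        {s | [true] <+: List.ofFn (fun i : Fin ((truncRun F nOf).nOf z.length + F.ancillas ((truncRun F nOf).nOf z.length)) =>
          s.getD (((truncRun F nOf).E z.length b i : Fin (z.length + (truncRun F nOf).anc z.length)) : ℕ) false)} =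
      nodeMean F x ρ := by
  classical
  have hseg' : (truncRun F nOf).inpB z b = fun i => x.get (Fin.cast hn i) := by
    rw [hseg]; funext i; rw [List.getD_eq_getElem _ _ (by rw [← hn]; exact i.2)]; rfl
  have hn' : KeyedBlocks.truncNOf F nOf z.length = x.length := hn
  have h := KeyedBlocks.trunc_kernelProb_full F nOf _ (keyedLang F) z b hb x hn.symm hseg' {y | [true] <+: y}
  have hset : {s : List Bool | List.ofFn (fun i : Fin ((truncRun F nOf).nOf z.length + F.ancillas ((truncRun F nOf).nOf z.length)) =>
      s.getD (((truncRun F nOf).E z.length b i : Fin (z.length + (truncRun F nOf).anc z.length)) : ℕ) false) ∈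
        {y : List Bool | [true] <+: y}} =
      {s | [true] <+: List.ofFn (fun i : Fin ((truncRun F nOf).nOf z.length + F.ancillas ((truncRun F nOf).nOf z.length)) =>
          s.getD (((truncRun F nOf).E z.length b i : Fin (z.length + (truncRun F nOf).anc z.length)) : ℕ) false)} := rfl
  rw [hset] at h
  rw [h, hdrop]
  change (1 / 2 : ℝ) ^ keyPoly.eval (kOf F (KeyedBlocks.truncNOf F nOf z.length) + mOf F (KeyedBlocks.truncNOf F nOf z.length)) *
      ∑ key : QReg (keyPoly.eval (kOf F (KeyedBlocks.truncNOf F nOf z.length) + mOf F (KeyedBlocks.truncNOf F nOf z.length))),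
        F.kernelProb (prefixSlice (keyedLang F) (paramStr (boolPair x (boolPair (encPath F x ρ) t)) pad ++ List.ofFn key))
          x {y | [true] <+: y} = _
  rw [hn', nodeMean_eq_hashedAvg F x (kOf F x.length) (mOf F x.length) le_rfl (by rw [mOf_length]; omega) ρ,
    one_div, inv_pow, ← div_eq_inv_mul]
  congr 1
  refine Finset.sum_congr rfl fun key _ => ?_
  rw [prefixSlice_keyedLang, kernelProb_prefix_true_eq_acceptProbOn]
  rfl

/-- **The SINGLE semantics of the truncated-runs estimator.** On an instance `z` well laid out for `(x, ρ, t, pad)`,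
`4T · Σ_{b<T} Pr[the transported query register of block b spells σ(s)] = bbbvMag F x ρ s`.
[cite: BennettBernsteinBrassardVazirani1997, Def. 3.2, Cor. 3.4] [cite: Zhandry2012IBE, Thm. 3.1] -/
theorem sum_kernelProb_truncRun_query_eq_bbbvMag (nOf : ℕ → ℕ) (z x : List Bool)
    (ρ : List (Fin (numOracleBits F x) × Bool)) (t pad : List Bool)
    (hn : (truncRun F nOf).nOf z.length = x.length)
    (hseg : ∀ b, (truncRun F nOf).inpB z b = fun i : Fin ((truncRun F nOf).nOf z.length) => x.getD (i : ℕ) false)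
    (hdrop : z.drop ((truncRun F nOf).MOf z.length * (truncRun F nOf).nOf z.length) =
      paramStr (boolPair x (boolPair (encPath F x ρ) t)) pad)
    (s : Fin (numOracleBits F x)) :
    4 * ((F.circ x.length).oracleQueries : ℝ) *
      ∑ b : Fin (oraclePositions (F.circ ((truncRun F nOf).nOf z.length)).gates).length,
        (truncRun F nOf).family.kernelProb (keyedLang F) z
          {s' | queryOf ((oraclePositions (F.circ ((truncRun F nOf).nOf z.length)).gates)[(b : ℕ)]).2.2
            (fun i => s'.getD (((truncRun F nOf).E z.length
              ⟨b, by rw [KeyedBlocks.trunc_MOf, ← length_oraclePositions]; exact Nat.lt_succ_of_lt b.2⟩ i :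
                Fin (z.length + (truncRun F nOf).anc z.length)) : ℕ) false) ∈ ({bitString F x s} : Set (List Bool))} =
      bbbvMag F x ρ s := by
  classical
  -- every block by the truncated-run identity
  have hb : ∀ b : Fin (oraclePositions (F.circ ((truncRun F nOf).nOf z.length)).gates).length,
      (truncRun F nOf).family.kernelProb (keyedLang F) z
          {s' | queryOf ((oraclePositions (F.circ ((truncRun F nOf).nOf z.length)).gates)[(b : ℕ)]).2.2
            (fun i => s'.getD (((truncRun F nOf).E z.length
              ⟨b, by rw [KeyedBlocks.trunc_MOf, ← length_oraclePositions]; exact Nat.lt_succ_of_lt b.2⟩ i :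
                Fin (z.length + (truncRun F nOf).anc z.length)) : ℕ) false) ∈ ({bitString F x s} : Set (List Bool))} =
        (1 / 2 : ℝ) ^ keyPoly.eval (kOf F ((truncRun F nOf).nOf z.length) + mOf F ((truncRun F nOf).nOf z.length)) *
          ∑ key : QReg (keyPoly.eval (kOf F ((truncRun F nOf).nOf z.length) + mOf F ((truncRun F nOf).nOf z.length))),
            (queryWeights (prefixSlice (keyedLang F) (paramStr (boolPair x (boolPair (encPath F x ρ) t)) pad ++ List.ofFn key))
              ({bitString F x s} : Set (List Bool)) (F.circ ((truncRun F nOf).nOf z.length)).gates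
              (basisState (padInput (fun i : Fin ((truncRun F nOf).nOf z.length) => x.getD (i : ℕ) false)
                (F.ancillas ((truncRun F nOf).nOf z.length)))))[(b : ℕ)]'(by
                  rw [queryWeights_eq_map_oraclePositions, List.length_map]; exact b.2) := by
    intro b
    have h := KeyedBlocks.trunc_kernelProb_query F nOf _ (keyedLang F) z
      ⟨b, by rw [KeyedBlocks.trunc_MOf, ← length_oraclePositions]; exact Nat.lt_succ_of_lt b.2⟩ b.2
      ({bitString F x s} : Set (List Bool))
    rw [h]
    simp only [hdrop, hseg]
  rw [Finset.sum_congr rfl fun b _ => hb b, ← Finset.mul_sum]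
  -- swap the sums and collect the list entries
  rw [Finset.sum_comm]
  have hcollect : ∀ key : QReg (keyPoly.eval (kOf F ((truncRun F nOf).nOf z.length) + mOf F ((truncRun F nOf).nOf z.length))),
      (∑ b : Fin (oraclePositions (F.circ ((truncRun F nOf).nOf z.length)).gates).length,
        (queryWeights (prefixSlice (keyedLang F) (paramStr (boolPair x (boolPair (encPath F x ρ) t)) pad ++ List.ofFn key))
          ({bitString F x s} : Set (List Bool)) (F.circ ((truncRun F nOf).nOf z.length)).gates
          (basisState (padInput (fun i : Fin ((truncRun F nOf).nOf z.length) => x.getD (i : ℕ) false)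
            (F.ancillas ((truncRun F nOf).nOf z.length)))))[(b : ℕ)]'(by
              rw [queryWeights_eq_map_oraclePositions, List.length_map]; exact b.2)) =
      (queryWeights (prefixSlice (keyedLang F) (paramStr (boolPair x (boolPair (encPath F x ρ) t)) pad ++ List.ofFn key))
          ({bitString F x s} : Set (List Bool)) (F.circ ((truncRun F nOf).nOf z.length)).gates
          (basisState (padInput (fun i : Fin ((truncRun F nOf).nOf z.length) => x.getD (i : ℕ) false)
            (F.ancillas ((truncRun F nOf).nOf z.length))))).sum :=
    fun key => sum_getElem_eq_sum _ _ (by rw [queryWeights_eq_map_oraclePositions, List.length_map])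
  simp only [hcollect]
  -- transport `nOf |z| ↦ |x|` and identify the hashed average
  have hn' : KeyedBlocks.truncNOf F nOf z.length = x.length := hn
  change 4 * ((F.circ x.length).oracleQueries : ℝ) *
      ((1 / 2 : ℝ) ^ keyPoly.eval (kOf F (KeyedBlocks.truncNOf F nOf z.length) + mOf F (KeyedBlocks.truncNOf F nOf z.length)) *
        ∑ key : QReg (keyPoly.eval (kOf F (KeyedBlocks.truncNOf F nOf z.length) + mOf F (KeyedBlocks.truncNOf F nOf z.length))),
          (queryWeights (prefixSlice (keyedLang F) (paramStr (boolPair x (boolPair (encPath F x ρ) t)) pad ++ List.ofFn key))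
            ({bitString F x s} : Set (List Bool)) (F.circ (KeyedBlocks.truncNOf F nOf z.length)).gates
            (basisState (padInput (fun i : Fin (KeyedBlocks.truncNOf F nOf z.length) => x.getD (i : ℕ) false)
              (F.ancillas (KeyedBlocks.truncNOf F nOf z.length))))).sum) = _
  rw [hn', padInput_getD_eq,
    bbbvMag_eq_hashedAvg F x (kOf F x.length) (mOf F x.length) le_rfl (by rw [mOf_length]; omega) ρ s,
    one_div, inv_pow, ← div_eq_inv_mul, ← Finset.mul_sum, mul_div_assoc]
  congr 2
  refine Finset.sum_congr rfl fun key _ => ?_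
  rw [prefixSlice_keyedLang]
  rfl

end SimTreePB

end Summit.QuantumAdvantage.QuantumAdvantage.Cruxes.TransferPB.Birth

end
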